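import Mathlib
import HarnessLib
import Summits.MatrixMultiplication.MatrixMultiplication.Theses.OutsiderSandwich
import Summits.MatrixMultiplication.MatrixMultiplication.Theorems.OutsiderSandwichBlockItems
import Summits.MatrixMultiplication.MatrixMultiplication.Theorems.OutsiderSandwichBlockOne
import Summits.MatrixMultiplication.MatrixMultiplication.Theorems.OutsiderSandwichBlockRank

/-!
# OutsiderSandwich — the one-block items over the route declarations (decomp-mm lens-4, g17)

The route file `Theses/OutsiderSandwich.lean` (rev 25) carries the g17 one-block asides
`BlockOneIsMM` (27147), `BlockOneTangency` (27148), `BlockOneMergeOptimal` (27149), `BlockBelowMM`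
(27150) — which spell out the coupled block `C₁ = T^{[211]}(cw₂^{⊗2})` verbatim and are
definitionally the Props of `Theorems/OutsiderSandwichBlockOne.lean` / `OutsiderSandwichBlock.lean`
— and the two proved asides `SummitIffBlockOne` (27151) and `BlockOneReduction` (27152), stated
over the sibling route decls.  This file records the definitional bridges and closes the two
proved asides by name:

* `summitIffBlockOne_holds : SummitIffBlockOne` — `ω = 2 ⟺ BlockOneTangency ∧ BlockOneMergeOptimal`
  (kernel `OutsiderSandwichBlockOne.summit_iff_blockOne`, hypothesis-free);
* `blockOneReduction_holds : BlockOneReduction` — `(ω = 2 ⟺ BlockOneIsMM ∧ CouplingMergeOptimal) ∧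
  (BlockIsMM ⟺ BlockOneIsMM) ∧ (BlockTangency ⟺ BlockOneTangency) ∧
  (BlockMergeOptimal ⟺ BlockOneMergeOptimal) ∧ (ω = 2 ⟹ BlockOneIsMM) ∧
  (BlockBelowMM ⟹ (ω = 2 ⟺ BlockRankLeFour))`.

The candidate one-block cut `closes (h₁ : BlockOneTangency) (h₂ : BlockOneMergeOptimal)
(h₃ : SummitIffBlockOne) : MatrixMultiplication := h₃.2 ⟨h₁, h₂⟩` is `summit_of_blockOne_items`.
-/

noncomputable section

namespace Summit.MatrixMultiplication.MatrixMultiplication.Theorems.OutsiderSandwichBlockOneItems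

open Summit.MatrixMultiplication.MatrixMultiplication

/-! ## 1. Definitional bridges route decl ↔ kernel Prop -/

/-- Item 27147 `BlockOneIsMM` is definitionally the kernel's `BlockOneIsMM`. -/
theorem blockOneIsMM_iff :
    Theses.OutsiderSandwich.BlockOneIsMM ↔ Theorems.OutsiderSandwichBlockOne.BlockOneIsMM :=
  Iff.rfl

/-- Item 27148 `BlockOneTangency` is definitionally the kernel's `BlockOneTangency`. -/
theorem blockOneTangency_iff :
    Theses.OutsiderSandwich.BlockOneTangency ↔ Theorems.OutsiderSandwichBlockOne.BlockOneTangency :=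
  Iff.rfl

/-- Item 27149 `BlockOneMergeOptimal` is definitionally the kernel's `BlockOneMergeOptimal`. -/
theorem blockOneMergeOptimal_iff :
    Theses.OutsiderSandwich.BlockOneMergeOptimal ↔
      Theorems.OutsiderSandwichBlockOne.BlockOneMergeOptimal :=
  Iff.rfl

/-- Item 27150 `BlockBelowMM` is definitionally the kernel's `BlockBelowMM` (`C₁ ≲ ⟨2,2,2⟩`). -/
theorem blockBelowMM_iff :
    Theses.OutsiderSandwich.BlockBelowMM ↔ Theorems.OutsiderSandwichBlock.BlockBelowMM :=
  Iff.rfl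

/-! ## 2. The two proved asides, by name -/

/-- Item 27151: `ω = 2 ⟺ BlockOneTangency ∧ BlockOneMergeOptimal` (hypothesis-free). -/
theorem summitIffBlockOne_holds : Theses.OutsiderSandwich.SummitIffBlockOne :=
  Theorems.OutsiderSandwichBlockOne.summit_iff_blockOne

/-- `BlockBelowMM ⟹ (ω = 2 ⟺ BlockRankLeFour)`, over the route decls (the route's `BlockRankLeFour`
bounds all three blocks; `R̃(C₂) = R̃(C₃) = R̃(C₁)`). -/
theorem summit_iff_blockRankLeFour_of_blockBelowMM (h : Theses.OutsiderSandwich.BlockBelowMM) :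
    _root_.MatrixMultiplication ↔ Theses.OutsiderSandwich.BlockRankLeFour :=
  (Theorems.OutsiderSandwichBlockRank.summit_iff_asymptoticRank_le_four h).trans
    ⟨fun h1 => OutsiderSandwichBlockItems.blockRankLeFour_iff.2
        ⟨h1, OutsiderSandwichCouplingBenchmark.asymptoticRank_coupling₂.trans_le h1,
          OutsiderSandwichCouplingBenchmark.asymptoticRank_coupling₃.trans_le h1⟩,
      fun h3 => (OutsiderSandwichBlockItems.blockRankLeFour_iff.1 h3).1⟩

/-- Item 27152: the one-block reduction edges. -/
theorem blockOneReduction_holds : Theses.OutsiderSandwich.BlockOneReduction :=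
  ⟨Theorems.OutsiderSandwichBlockOne.summit_iff_blockOneIsMM,
    Theorems.OutsiderSandwichBlockOne.blockIsMM_iff_one,
    Theorems.OutsiderSandwichBlockOne.blockTangency_iff_one,
    Theorems.OutsiderSandwichBlockOne.blockMergeOptimal_iff_one,
    Theorems.OutsiderSandwichBlockOne.blockOneIsMM_of_summit,
    summit_iff_blockRankLeFour_of_blockBelowMM⟩

/-! ## 3. Edges over the route decls -/

/-- `ω = 2 ⟺ BlockOneIsMM ∧ CouplingMergeOptimal`, over the route decls (unconditional). -/
theorem summit_iff_blockOneIsMM_items :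
    _root_.MatrixMultiplication ↔
      (Theses.OutsiderSandwich.BlockOneIsMM ∧ Theses.OutsiderSandwich.CouplingMergeOptimal) :=
  Theorems.OutsiderSandwichBlockOne.summit_iff_blockOneIsMM

/-- `ω = 2 ⟹ BlockOneIsMM`: the one-block leaf is NECESSARY, over the route decls. -/
theorem blockOneIsMM_of_summit_items (hS : _root_.MatrixMultiplication) :
    Theses.OutsiderSandwich.BlockOneIsMM :=
  Theorems.OutsiderSandwichBlockOne.blockOneIsMM_of_summit hS

/-- `BlockBelowMM ⟹ BlockOneMergeOptimal ∧ BlockMergeOptimal`, over the route decls. -/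
theorem mergeOptimal_of_blockBelowMM_items (h : Theses.OutsiderSandwich.BlockBelowMM) :
    Theses.OutsiderSandwich.BlockOneMergeOptimal ∧ Theses.OutsiderSandwich.BlockMergeOptimal :=
  ⟨Theorems.OutsiderSandwichBlockOne.blockMergeOptimal_iff_one.1
      (Theorems.OutsiderSandwichBlock.blockMergeOptimal_of_blockBelowMM h),
    Theorems.OutsiderSandwichBlock.blockMergeOptimal_of_blockBelowMM h⟩

/-- The candidate ONE-BLOCK CUT over the route decls:
`BlockOneTangency → BlockOneMergeOptimal → SummitIffBlockOne → ω = 2`. -/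
theorem summit_of_blockOne_items (h₁ : Theses.OutsiderSandwich.BlockOneTangency)
    (h₂ : Theses.OutsiderSandwich.BlockOneMergeOptimal)
    (h₃ : Theses.OutsiderSandwich.SummitIffBlockOne) : _root_.MatrixMultiplication :=
  h₃.2 ⟨h₁, h₂⟩

/-- … and without the proved bridge as a hypothesis. -/
theorem summit_of_blockOne_items' (h₁ : Theses.OutsiderSandwich.BlockOneTangency)
    (h₂ : Theses.OutsiderSandwich.BlockOneMergeOptimal) : _root_.MatrixMultiplication :=
  summitIffBlockOne_holds.2 ⟨h₁, h₂⟩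

end Summit.MatrixMultiplication.MatrixMultiplication.Theorems.OutsiderSandwichBlockOneItems
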